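import Literature.NumberTheory.EllipticCurves.BhargavaShankarLocalMasses
import Mathlib.Data.Nat.ChineseRemainder
import Mathlib.Data.Nat.Factorization.Basic
import HarnessLib

/-!
# Bhargava–Shankar, eq. (31): the local masses for the family of all elliptic curves — proofs
# (`F_p^{inv}` explicitly, `M_p(U₁,F) = |3⁴|_p (1 − p⁻¹⁰)`, the discriminant curve is null, and
# `M_p(V,F) = (1 − p⁻²)·c_p·M_p(U₁,F)` from Lemma 5.16)

`Proofs` companion of `BhargavaShankarLocalMasses.lean` (theorems only). Source and numbering as
there: M. Bhargava, A. Shankar, Ann. of Math. (2) 181 (2015) 191–242, held arXiv text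
`arXiv:1006.1002v2`, §5.2–5.4.

## Contents (all proved)

1. **`F_p^{inv}` explicitly** (`invariantPairsAdicClosure_eq`): the `p`-adic closure of
   `F^{inv} = {(−3A, −27B) : (A,B) ∈ ℤ², 4A³+27B² ≠ 0, no q⁴ ∣ A ∧ q⁶ ∣ B}` in `ℤ_p × ℤ_p` is
   `{(−3A, −27B) : (A, B) ∈ ℤ_p², p⁴ ∤ A or p⁶ ∤ B}` (`invariantPairsAdic p`). The inclusion `⊇`
   is an integral approximation inside the family (`exists_isInHeightFamily_near`): given
   `(a,b)` and `N`, take `A = (a mod pᴺ) + pᴺ > 0` and, by the Chinese remainder theorem,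
   `B ≡ b (mod pᴺ)`, `B ≡ 1 (mod A')` with `A'` the prime-to-`p` part of `A`; then `4A³+27B² > 0`
   and no prime `q` has `q⁴ ∣ A`, `q⁶ ∣ B`.
2. **`M_p(U₁,F) = |3⁴|_p (1 − p⁻¹⁰)`** (`localMassU_eq`; Bhargava–Shankar eq. (28), the factor
   of Lemma 5.15): for `p ≠ 3` the set is `{p⁴ ∤ I or p⁶ ∤ J}` of measure `1 − p⁻⁴p⁻⁶`; for
   `p = 3` it is `{3 ∣ I, 27 ∣ J} ∖ {3⁵ ∣ I, 3⁹ ∣ J}` of measure `3⁻⁴ − 3⁻¹⁴`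
   (`Literature/MeasureTheory/Group/PadicIntHaar`: residue classes mod `pⁿ` have measure `p⁻ⁿ`).
3. **The discriminant curve `4I³ = J²` is a null set** of `ℤ_p × ℤ_p` (`volume_discCurve`:
   its `I`-sections have at most two points).
4. **`M_p(V,F) = (1 − p⁻²)·c_p·M_p(U₁,F)`**, `c₂ = 2`, `c_p = 1` otherwise (`localMassV_eq`),
   granted Lemma 5.16 (Brumer–Kramer, the tree's named fact `brumerKramer_card_quotient_two`):
   off the discriminant curve `E_{I,J}` is an elliptic curve over `ℚ_p`
   (`isElliptic_curveOfInvariants`, `Δ = 16(4I³−J²)/27`), its `2`-torsion over `ℚ_p` is finite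
   (`finite_torsionBy_two`: `2P = O` iff `y(P) = 0`, `x(P)` a root of the `2`-torsion cubic) and
   nonempty, so Lemma 5.16 gives the integrand `#(E/2E)/#E[2] = c_p` (`localSelmerRatio_eq`);
   this is the last display of §5.4 of the source at the level of the local factor.

## References

* M. Bhargava, A. Shankar, Ann. of Math. (2) 181 (2015) 191–242 = arXiv:1006.1002, §5.2
  (Prop. 5.12, eq. (28)), §5.4 (Lemma 5.15, Lemma 5.16, eq. (31)), arXiv v2 numbering.
  [cite: BhargavaShankarAnnals2015, Prop. 5.12 and §5.4 (arXiv:1006.1002v2 numbering)]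
* A. Brumer, K. Kramer, *The rank of elliptic curves*, Duke Math. J. 44 (1977) (Lemma 5.16).

## Design

No definitions. `open _root_.MeasureTheory` (the directory `Literature/MeasureTheory` shadows
the Mathlib namespace inside `namespace Literature.…`, CONVENTIONS §2).
-/

noncomputable section

open scoped Classical ENNReal

namespace Literature.NumberTheory.EllipticCurves

open _root_.MeasureTheory Filter Topology Set

section Closure

variable (p : ℕ) [Fact p.Prime]

/-! ## The explicit description of `F_p^{inv}` -/

/-- Divisibility by `p^k` passes from `ℤ` to `ℤ_p`. [folklore] -/
theorem padicInt_pow_dvd_intCast_of_dvd {k : ℕ} {A : ℤ} (h : (p : ℤ) ^ k ∣ A) :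
    (p : ℤ_[p]) ^ k ∣ (A : ℤ_[p]) := by
  obtain ⟨c, rfl⟩ := h
  exact ⟨(c : ℤ_[p]), by push_cast; ring⟩

/-- Divisibility by `p^k` descends from `ℤ_p` to `ℤ` (`‖A‖_p ≤ p⁻ᵏ ⇔ pᵏ ∣ A`). [folklore] -/
theorem pow_dvd_of_padicInt_pow_dvd_intCast {k : ℕ} {A : ℤ} (h : (p : ℤ_[p]) ^ k ∣ (A : ℤ_[p])) :
    (p : ℤ) ^ k ∣ A := by
  have h' : (A : ℤ_[p]) ∈ Ideal.span {(p : ℤ_[p]) ^ k} := Ideal.mem_span_singleton.mpr h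
  rw [← PadicInt.norm_le_pow_iff_mem_span_pow] at h'
  exact (PadicInt.norm_int_le_pow_iff_dvd (p := p) (k := A) (n := k)).mp h'

/-- The image of `F^{inv}` in `ℤ_p × ℤ_p` lies in `{(−3A, −27B) : p⁴ ∤ A or p⁶ ∤ B}`.
[cite: BhargavaShankarAnnals2015, §5 p. 31 (arXiv:1006.1002v2 numbering)] -/
theorem image_invariantPairs_subset_invariantPairsAdic :
    (fun IJ : ℤ × ℤ ↦ ((IJ.1 : ℤ_[p]), (IJ.2 : ℤ_[p]))) '' invariantPairs ⊆ invariantPairsAdic p := by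
  rintro _ ⟨IJ, ⟨AB, hAB, rfl⟩, rfl⟩
  refine (mem_invariantPairsAdic_iff p _).mpr ⟨((AB.1 : ℤ_[p]), (AB.2 : ℤ_[p])), ?_, ?_⟩
  · rw [mem_minimalPairsAdic_iff]
    rintro ⟨h4, h6⟩
    exact hAB.2 p (Fact.out) ⟨pow_dvd_of_padicInt_pow_dvd_intCast p h4,
      pow_dvd_of_padicInt_pow_dvd_intCast p h6⟩
  · simp

/-- `{(A, B) : p⁴ ∤ A or p⁶ ∤ B}` is closed in `ℤ_p × ℤ_p` (divisibility by `pᵏ` is a closed-ball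
condition, so its negation is open and closed). [folklore] -/
theorem isClosed_minimalPairsAdic : IsClosed (minimalPairsAdic p) := by
  have h4 : IsOpen {A : ℤ_[p] | (p : ℤ_[p]) ^ 4 ∣ A} := by
    have : {A : ℤ_[p] | (p : ℤ_[p]) ^ 4 ∣ A} = Metric.closedBall (0 : ℤ_[p]) ((p : ℝ) ^ (-(4 : ℕ) : ℤ)) := by
      ext A
      simp only [mem_setOf_eq, Metric.mem_closedBall, dist_zero_right]
      rw [PadicInt.norm_le_pow_iff_mem_span_pow, Ideal.mem_span_singleton]
    rw [this]
    exact IsUltrametricDist.isOpen_closedBall _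
      (zpow_pos (by exact_mod_cast (Fact.out : p.Prime).pos) _).ne'
  have h6 : IsOpen {B : ℤ_[p] | (p : ℤ_[p]) ^ 6 ∣ B} := by
    have : {B : ℤ_[p] | (p : ℤ_[p]) ^ 6 ∣ B} = Metric.closedBall (0 : ℤ_[p]) ((p : ℝ) ^ (-(6 : ℕ) : ℤ)) := by
      ext B
      simp only [mem_setOf_eq, Metric.mem_closedBall, dist_zero_right]
      rw [PadicInt.norm_le_pow_iff_mem_span_pow, Ideal.mem_span_singleton]
    rw [this]
    exact IsUltrametricDist.isOpen_closedBall _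
      (zpow_pos (by exact_mod_cast (Fact.out : p.Prime).pos) _).ne'
  have hopen : IsOpen {AB : ℤ_[p] × ℤ_[p] | (p : ℤ_[p]) ^ 4 ∣ AB.1 ∧ (p : ℤ_[p]) ^ 6 ∣ AB.2} :=
    (h4.preimage continuous_fst).inter (h6.preimage continuous_snd)
  have : minimalPairsAdic p = {AB : ℤ_[p] × ℤ_[p] | (p : ℤ_[p]) ^ 4 ∣ AB.1 ∧ (p : ℤ_[p]) ^ 6 ∣ AB.2}ᶜ := by
    ext AB; rfl
  rw [this]
  exact hopen.isClosed_compl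

/-- `{(−3A, −27B) : p⁴ ∤ A or p⁶ ∤ B}` is closed (continuous image of a compact set). [folklore] -/
theorem isClosed_invariantPairsAdic : IsClosed (invariantPairsAdic p) := by
  refine ((isClosed_minimalPairsAdic p).isCompact.image ?_).isClosed
  fun_prop

/-- `F_p^{inv} ⊆ {(−3A, −27B) : p⁴ ∤ A or p⁶ ∤ B}`. [cite: BhargavaShankarAnnals2015, §5 p. 31 (arXiv:1006.1002v2 numbering)] -/
theorem invariantPairsAdicClosure_subset : invariantPairsAdicClosure p ⊆ invariantPairsAdic p :=
  closure_minimal (image_invariantPairs_subset_invariantPairsAdic p) (isClosed_invariantPairsAdic p)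

end Closure

section Density

variable (p : ℕ) [Fact p.Prime]

/-- `pᴺ ∣ x − (x mod pᴺ)` in `ℤ_p` (`PadicInt.appr_spec`). [folklore] -/
theorem padicInt_pow_dvd_sub_appr (x : ℤ_[p]) (N : ℕ) :
    (p : ℤ_[p]) ^ N ∣ x - (PadicInt.appr x N : ℤ_[p]) :=
  Ideal.mem_span_singleton.mp (PadicInt.appr_spec N x)

/-- `‖x‖ ≤ p⁻ᴺ ⇔ pᴺ ∣ x` in `ℤ_p`. [folklore] -/
theorem padicInt_norm_le_pow_iff_pow_dvd (x : ℤ_[p]) (N : ℕ) :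
    ‖x‖ ≤ (p : ℝ) ^ (-(N : ℤ)) ↔ (p : ℤ_[p]) ^ N ∣ x := by
  rw [PadicInt.norm_le_pow_iff_mem_span_pow, Ideal.mem_span_singleton]

/-- **Integral approximation inside the height family** (Chinese remainder theorem): every
`(a, b) ∈ ℤ_p²` with `p⁴ ∤ a` or `p⁶ ∤ b` is, for every `N ≥ 6`, within `p⁻ᴺ` of (the image of)
a pair `(A, B) ∈ ℤ²` with `4A³ + 27B² ≠ 0` and `q⁴ ∤ A` or `q⁶ ∤ B` for every prime `q`: take
`A = (a mod pᴺ) + pᴺ > 0` and `B ≡ b (mod pᴺ)`, `B ≡ 1 (mod A')`, `A'` the prime-to-`p` part of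
`A`, so that every prime `q ≠ p` dividing `A` does not divide `B`. [folklore] -/
theorem exists_isInHeightFamily_near {a b : ℤ_[p]}
    (hab : ¬ ((p : ℤ_[p]) ^ 4 ∣ a ∧ (p : ℤ_[p]) ^ 6 ∣ b)) {N : ℕ} (hN : 6 ≤ N) :
    ∃ AB : ℤ × ℤ, IsInHeightFamily AB ∧ ‖((AB.1 : ℤ) : ℤ_[p]) - a‖ ≤ (p : ℝ) ^ (-(N : ℤ)) ∧
      ‖((AB.2 : ℤ) : ℤ_[p]) - b‖ ≤ (p : ℝ) ^ (-(N : ℤ)) := by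
  have hp : p.Prime := Fact.out
  obtain ⟨aN, haN⟩ : ∃ aN : ℕ, PadicInt.appr a N = aN := ⟨_, rfl⟩
  obtain ⟨bN, hbN⟩ : ∃ bN : ℕ, PadicInt.appr b N = bN := ⟨_, rfl⟩
  have ha : (p : ℤ_[p]) ^ N ∣ a - (aN : ℤ_[p]) := haN ▸ padicInt_pow_dvd_sub_appr p a N
  have hb : (p : ℤ_[p]) ^ N ∣ b - (bN : ℤ_[p]) := hbN ▸ padicInt_pow_dvd_sub_appr p b N
  obtain ⟨A', hA'⟩ : ∃ A' : ℕ, aN + p ^ N = A' := ⟨_, rfl⟩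
  have hpN : 0 < p ^ N := Nat.pow_pos hp.pos
  have hA'pos : 0 < A' := hA' ▸ Nat.add_pos_right _ hpN
  obtain ⟨M, hM⟩ : ∃ M : ℕ, ordCompl[p] A' = M := ⟨_, rfl⟩
  have hcopM : Nat.Coprime p M := hM ▸ Nat.coprime_ordCompl hp hA'pos.ne'
  have hco : Nat.Coprime (p ^ N) M := Nat.Coprime.pow_left N hcopM
  obtain ⟨B, hBmod, hB1⟩ := Nat.chineseRemainder hco bN 1
  -- divisibility bookkeeping in `ℤ_p`
  have hAa : (p : ℤ_[p]) ^ N ∣ (A' : ℤ_[p]) - a := by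
    have : (A' : ℤ_[p]) - a = -(a - (aN : ℤ_[p])) + (p : ℤ_[p]) ^ N := by
      rw [← hA']; push_cast; ring
    rw [this]
    exact dvd_add (dvd_neg.mpr ha) dvd_rfl
  have hBb : (p : ℤ_[p]) ^ N ∣ (B : ℤ_[p]) - b := by
    have h1 : ((p ^ N : ℕ) : ℤ) ∣ (bN : ℤ) - (B : ℤ) := (Nat.modEq_iff_dvd.mp hBmod)
    have h1' : (p : ℤ_[p]) ^ N ∣ (bN : ℤ_[p]) - (B : ℤ_[p]) := by
      obtain ⟨c, hc⟩ := h1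
      refine ⟨-(-c : ℤ_[p]), ?_⟩
      have := congrArg (fun z : ℤ ↦ (z : ℤ_[p])) hc
      push_cast at this ⊢
      linear_combination this
    have : (B : ℤ_[p]) - b = -((bN : ℤ_[p]) - (B : ℤ_[p])) + -(b - (bN : ℤ_[p])) := by ring
    rw [this]
    exact dvd_add (dvd_neg.mpr h1') (dvd_neg.mpr hb)
  refine ⟨((A' : ℤ), (B : ℤ)), ⟨?_, ?_⟩, ?_, ?_⟩
  · -- `4A³ + 27B² > 0` since `A > 0`
    have hA'posZ : (0 : ℤ) < (A' : ℤ) := by exact_mod_cast hA'pos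
    have h3 := pow_pos hA'posZ 3
    simp only
    nlinarith [sq_nonneg (B : ℤ)]
  · rintro q hq ⟨h4, h6⟩
    simp only at h4 h6
    by_cases hqp : q = p
    · rw [hqp] at h4 h6
      apply hab
      have h4' : (p : ℤ_[p]) ^ 4 ∣ (A' : ℤ_[p]) := by
        have := padicInt_pow_dvd_intCast_of_dvd p h4
        push_cast at this
        exact this
      have h6' : (p : ℤ_[p]) ^ 6 ∣ (B : ℤ_[p]) := by
        have := padicInt_pow_dvd_intCast_of_dvd p h6
        push_cast at this
        exact this
      have hN4 : (p : ℤ_[p]) ^ 4 ∣ (p : ℤ_[p]) ^ N := pow_dvd_pow _ (by omega)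
      have hN6 : (p : ℤ_[p]) ^ 6 ∣ (p : ℤ_[p]) ^ N := pow_dvd_pow _ hN
      constructor
      · have : a = (A' : ℤ_[p]) - ((A' : ℤ_[p]) - a) := by ring
        rw [this]
        exact dvd_sub h4' (hN4.trans hAa)
      · have : b = (B : ℤ_[p]) - ((B : ℤ_[p]) - b) := by ring
        rw [this]
        exact dvd_sub h6' (hN6.trans hBb)
    · -- `q ≠ p`: `q ∣ A` forces `q ∣ M`, but `B ≡ 1 (mod M)`
      have hqA : q ∣ A' := by
        have : (q : ℤ) ∣ (A' : ℤ) := (dvd_pow_self (q : ℤ) four_ne_zero).trans h4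
        exact_mod_cast this
      have hqB : q ∣ B := by
        have : (q : ℤ) ∣ (B : ℤ) := (dvd_pow_self (q : ℤ) (by norm_num)).trans h6
        exact_mod_cast this
      have hqM : q ∣ M := by
        have hdecomp : ordProj[p] A' * M = A' := hM ▸ Nat.ordProj_mul_ordCompl_eq_self A' p
        have hcop : Nat.Coprime q (ordProj[p] A') :=
          Nat.Coprime.pow_right _ ((Nat.coprime_primes hq hp).mpr hqp)
        have hqA' : q ∣ ordProj[p] A' * M := by rwa [hdecomp]
        exact hcop.dvd_of_dvd_mul_left hqA'
      have hB1q : B ≡ 1 [MOD q] := hB1.of_dvd hqM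
      have e : B % q = 1 % q := hB1q
      have h1 : 1 % q = 0 := by rw [← e]; exact Nat.mod_eq_zero_of_dvd hqB
      exact hq.ne_one (Nat.dvd_one.mp (Nat.dvd_of_mod_eq_zero h1))
  · show ‖((A' : ℤ) : ℤ_[p]) - a‖ ≤ _
    rw [Int.cast_natCast, padicInt_norm_le_pow_iff_pow_dvd]
    exact hAa
  · show ‖((B : ℤ) : ℤ_[p]) - b‖ ≤ _
    rw [Int.cast_natCast, padicInt_norm_le_pow_iff_pow_dvd]
    exact hBb

/-- `p⁻ᴺ → 0`. [folklore] -/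
theorem tendsto_padic_zpow_neg_atTop :
    Tendsto (fun N : ℕ ↦ (p : ℝ) ^ (-(N : ℤ))) atTop (𝓝 0) := by
  have hp : p.Prime := Fact.out
  have h1 : (fun N : ℕ ↦ (p : ℝ) ^ (-(N : ℤ))) = fun N : ℕ ↦ ((p : ℝ)⁻¹) ^ N := by
    ext N; rw [zpow_neg, zpow_natCast, inv_pow]
  rw [h1]
  exact tendsto_pow_atTop_nhds_zero_of_lt_one (by positivity)
    (inv_lt_one_of_one_lt₀ (by exact_mod_cast hp.one_lt))

/-- `{(−3A, −27B) : p⁴ ∤ A or p⁶ ∤ B} ⊆ F_p^{inv}`: every such pair is a `p`-adic limit of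
invariant pairs `(−3A_N, −27B_N)` of curves in the family (`exists_isInHeightFamily_near`).
[cite: BhargavaShankarAnnals2015, §5 p. 31 (arXiv:1006.1002v2 numbering)] -/
theorem invariantPairsAdic_subset_closure : invariantPairsAdic p ⊆ invariantPairsAdicClosure p := by
  rintro _ ⟨⟨a, b⟩, hab, rfl⟩
  rw [mem_minimalPairsAdic_iff] at hab
  choose AB hfam hA hB using fun N : ℕ ↦
    exists_isInHeightFamily_near p hab (N := N + 6) (by omega)
  have hlim : Tendsto (fun N : ℕ ↦ ((((-3 * (AB N).1 : ℤ)) : ℤ_[p]), (((-27 * (AB N).2 : ℤ)) : ℤ_[p])))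
      atTop (𝓝 ((-3 * a, -27 * b) : ℤ_[p] × ℤ_[p])) := by
    have h0 : Tendsto (fun N : ℕ ↦ (p : ℝ) ^ (-((N + 6 : ℕ) : ℤ))) atTop (𝓝 0) :=
      (tendsto_padic_zpow_neg_atTop p).comp (tendsto_add_atTop_nat 6)
    refine Tendsto.prodMk_nhds ?_ ?_
    · rw [tendsto_iff_norm_sub_tendsto_zero]
      refine squeeze_zero (fun N ↦ norm_nonneg _) (fun N ↦ ?_) h0
      calc ‖(((-3 * (AB N).1 : ℤ)) : ℤ_[p]) - -3 * a‖ = ‖(-3 : ℤ_[p]) * (((AB N).1 : ℤ_[p]) - a)‖ := by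
            push_cast; ring_nf
        _ ≤ ‖(((AB N).1 : ℤ_[p]) - a)‖ := by
            rw [norm_mul]; exact mul_le_of_le_one_left (norm_nonneg _) (PadicInt.norm_le_one _)
        _ ≤ (p : ℝ) ^ (-((N + 6 : ℕ) : ℤ)) := hA N
    · rw [tendsto_iff_norm_sub_tendsto_zero]
      refine squeeze_zero (fun N ↦ norm_nonneg _) (fun N ↦ ?_) h0
      calc ‖(((-27 * (AB N).2 : ℤ)) : ℤ_[p]) - -27 * b‖ = ‖(-27 : ℤ_[p]) * (((AB N).2 : ℤ_[p]) - b)‖ := by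
            push_cast; ring_nf
        _ ≤ ‖(((AB N).2 : ℤ_[p]) - b)‖ := by
            rw [norm_mul]; exact mul_le_of_le_one_left (norm_nonneg _) (PadicInt.norm_le_one _)
        _ ≤ (p : ℝ) ^ (-((N + 6 : ℕ) : ℤ)) := hB N
  refine mem_closure_of_tendsto hlim (Eventually.of_forall fun N ↦ ?_)
  exact ⟨(-3 * (AB N).1, -27 * (AB N).2), ⟨AB N, hfam N, rfl⟩, rfl⟩

/-- **`F_p^{inv}` for the family of all elliptic curves is `{(−3A, −27B) : (A,B) ∈ ℤ_p², p⁴ ∤ A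
or p⁶ ∤ B}`.** [cite: BhargavaShankarAnnals2015, §5 p. 31 (F_p^{inv}; arXiv:1006.1002v2 numbering)] -/
theorem invariantPairsAdicClosure_eq : invariantPairsAdicClosure p = invariantPairsAdic p :=
  Subset.antisymm (invariantPairsAdicClosure_subset p) (invariantPairsAdic_subset_closure p)

end Density

section Volume

variable (p : ℕ) [Fact p.Prime]

/-! ## The measure of `F_p^{inv}`: `M_p(U₁,F) = |3⁴|_p (1 − p⁻¹⁰)` -/

/-- `volume` on `ℤ_p × ℤ_p` is the product of the Haar probability measures. [folklore] -/
theorem volume_prod_setOf_pow_dvd (m n : ℕ) :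
    volume ({A : ℤ_[p] | (p : ℤ_[p]) ^ m ∣ A} ×ˢ {B : ℤ_[p] | (p : ℤ_[p]) ^ n ∣ B}) =
      ((p : ℝ≥0∞) ^ m)⁻¹ * ((p : ℝ≥0∞) ^ n)⁻¹ := by
  rw [Measure.volume_eq_prod, Measure.prod_prod,
    Literature.MeasureTheory.Group.padicInt_volume_setOf_pow_dvd,
    Literature.MeasureTheory.Group.padicInt_volume_setOf_pow_dvd]

/-- `3` is a unit of `ℤ_p` for `p ≠ 3`. [folklore] -/
theorem isUnit_three_padicInt (hp3 : p ≠ 3) : IsUnit (3 : ℤ_[p]) := by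
  rw [PadicInt.isUnit_iff]
  have hle : ‖(3 : ℤ_[p])‖ ≤ 1 := PadicInt.norm_le_one _
  have hlt : ¬ ‖(3 : ℤ_[p])‖ < 1 := by
    intro h
    have h' : ‖((3 : ℤ) : ℤ_[p])‖ < 1 := by push_cast; exact h
    rw [PadicInt.norm_int_lt_one_iff_dvd] at h'
    have h3 : (p : ℤ) ∣ (3 : ℕ) := by exact_mod_cast h'
    have : p ∣ 3 := by exact_mod_cast h3
    exact hp3 ((Nat.prime_dvd_prime_iff_eq (Fact.out) Nat.prime_three).mp this)
  exact le_antisymm hle (not_lt.mp hlt)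

/-- For `p ≠ 3`, `F_p^{inv} = {(I,J) : p⁴ ∤ I or p⁶ ∤ J}` (`−3`, `−27` are `p`-adic units).
[cite: BhargavaShankarAnnals2015, §5 p. 31 (arXiv:1006.1002v2 numbering)] -/
theorem invariantPairsAdic_eq_of_ne_three (hp3 : p ≠ 3) :
    invariantPairsAdic p = minimalPairsAdic p := by
  have h3 : IsUnit (3 : ℤ_[p]) := isUnit_three_padicInt p hp3
  have h27 : IsUnit (27 : ℤ_[p]) := by
    have : (27 : ℤ_[p]) = 3 * 3 * 3 := by norm_num
    rw [this]; exact (h3.mul h3).mul h3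
  have hn3 : IsUnit (-3 : ℤ_[p]) := h3.neg
  have hn27 : IsUnit (-27 : ℤ_[p]) := h27.neg
  ext ⟨I, J⟩
  rw [mem_invariantPairsAdic_iff, mem_minimalPairsAdic_iff]
  constructor
  · rintro ⟨⟨A, B⟩, hAB, hIJ⟩
    rw [mem_minimalPairsAdic_iff] at hAB
    simp only [Prod.mk.injEq] at hIJ
    obtain ⟨rfl, rfl⟩ := hIJ
    simpa only [hn3.dvd_mul_left, hn27.dvd_mul_left] using hAB
  · intro hIJ
    obtain ⟨u3, hu3⟩ := hn3
    obtain ⟨u27, hu27⟩ := hn27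
    refine ⟨(↑u3⁻¹ * I, ↑u27⁻¹ * J), ?_, ?_⟩
    · rw [mem_minimalPairsAdic_iff]
      simpa only [Units.isUnit _ |>.dvd_mul_left] using hIJ
    · simp only [Prod.mk.injEq]
      constructor
      · rw [← hu3, ← mul_assoc, Units.mul_inv, one_mul]
      · rw [← hu27, ← mul_assoc, Units.mul_inv, one_mul]

/-- For `p = 3`, `F_3^{inv} = {(I,J) : 3 ∣ I, 27 ∣ J, and 3⁵ ∤ I or 3⁹ ∤ J}`.
[cite: BhargavaShankarAnnals2015, §5 p. 31 (arXiv:1006.1002v2 numbering)] -/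
theorem invariantPairsAdic_three :
    invariantPairsAdic 3 = ({I : ℤ_[3] | (3 : ℤ_[3]) ^ 1 ∣ I} ×ˢ {J : ℤ_[3] | (3 : ℤ_[3]) ^ 3 ∣ J}) \
      ({I : ℤ_[3] | (3 : ℤ_[3]) ^ 5 ∣ I} ×ˢ {J : ℤ_[3] | (3 : ℤ_[3]) ^ 9 ∣ J}) := by
  have h30 : (3 : ℤ_[3]) ≠ 0 := by exact_mod_cast (show ((3 : ℕ) : ℤ_[3]) ≠ 0 from by
    rw [Ne, ← norm_eq_zero]; simp)
  ext ⟨I, J⟩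
  simp only [mem_invariantPairsAdic_iff, mem_minimalPairsAdic_iff, Set.mem_sdiff, mem_prod, mem_setOf_eq,
    pow_one, Prod.mk.injEq, Nat.cast_ofNat]
  constructor
  · rintro ⟨⟨A, B⟩, hAB, rfl, rfl⟩
    refine ⟨⟨⟨-A, by ring⟩, ⟨-B, by ring⟩⟩, ?_⟩
    rintro ⟨⟨c, hc⟩, ⟨d, hd⟩⟩
    apply hAB
    constructor
    · refine ⟨-c, ?_⟩
      have : (3 : ℤ_[3]) * (3 ^ 4 * -c) = 3 * A := by linear_combination hc
      exact (mul_left_cancel₀ h30 this).symm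
    · refine ⟨-d, ?_⟩
      have h27 : (27 : ℤ_[3]) ≠ 0 := by
        have : (27 : ℤ_[3]) = 3 * 3 * 3 := by norm_num
        rw [this]; exact mul_ne_zero (mul_ne_zero h30 h30) h30
      have : (27 : ℤ_[3]) * (3 ^ 6 * -d) = 27 * B := by linear_combination hd
      exact (mul_left_cancel₀ h27 this).symm
  · rintro ⟨⟨⟨a, rfl⟩, ⟨b, rfl⟩⟩, hn⟩
    refine ⟨(-a, -b), ?_, by ring, by ring⟩
    rintro ⟨⟨c, hc⟩, ⟨d, hd⟩⟩
    simp only at hc hd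
    apply hn
    exact ⟨⟨-c, by linear_combination (-3 : ℤ_[3]) * hc⟩,
      ⟨-d, by linear_combination (-27 : ℤ_[3]) * hd⟩⟩

/-- The sets `{(A,B) : pᵐ ∣ A, pⁿ ∣ B}` are measurable. [folklore] -/
theorem measurableSet_prod_setOf_pow_dvd (m n : ℕ) :
    MeasurableSet ({A : ℤ_[p] | (p : ℤ_[p]) ^ m ∣ A} ×ˢ {B : ℤ_[p] | (p : ℤ_[p]) ^ n ∣ B}) :=
  (Literature.MeasureTheory.Group.padicInt_measurableSet_setOf_pow_dvd m).prod
    (Literature.MeasureTheory.Group.padicInt_measurableSet_setOf_pow_dvd n)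

/-- **`μ(F_p^{inv}) = 1 − p⁻¹⁰` for `p ≠ 3`.** [cite: BhargavaShankarAnnals2015, Lemma 5.15 and eq. (28) (arXiv:1006.1002v2 numbering)] -/
theorem volume_invariantPairsAdic_of_ne_three (hp3 : p ≠ 3) :
    volume (invariantPairsAdic p) = 1 - ((p : ℝ≥0∞) ^ 10)⁻¹ := by
  rw [invariantPairsAdic_eq_of_ne_three p hp3]
  have hset : minimalPairsAdic p =
      ({A : ℤ_[p] | (p : ℤ_[p]) ^ 4 ∣ A} ×ˢ {B : ℤ_[p] | (p : ℤ_[p]) ^ 6 ∣ B})ᶜ := by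
    ext ⟨A, B⟩; simp [mem_minimalPairsAdic_iff, mem_prod]
  rw [hset, measure_compl (measurableSet_prod_setOf_pow_dvd p 4 6) (measure_ne_top _ _),
    measure_univ, volume_prod_setOf_pow_dvd, ← ENNReal.mul_inv (Or.inl ?_) (Or.inl ?_), ← pow_add]
  all_goals simp [(Fact.out : p.Prime).ne_zero]

/-- **`μ(F_3^{inv}) = 3⁻⁴ − 3⁻¹⁴ = 3⁻⁴ (1 − 3⁻¹⁰)`.** [cite: BhargavaShankarAnnals2015, Lemma 5.15 and eq. (28) (arXiv:1006.1002v2 numbering)] -/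
theorem volume_invariantPairsAdic_three :
    volume (invariantPairsAdic 3) = ((3 : ℝ≥0∞) ^ 4)⁻¹ - ((3 : ℝ≥0∞) ^ 14)⁻¹ := by
  rw [invariantPairsAdic_three]
  have hsub : ({I : ℤ_[3] | (3 : ℤ_[3]) ^ 5 ∣ I} ×ˢ {J : ℤ_[3] | (3 : ℤ_[3]) ^ 9 ∣ J}) ⊆
      ({I : ℤ_[3] | (3 : ℤ_[3]) ^ 1 ∣ I} ×ˢ {J : ℤ_[3] | (3 : ℤ_[3]) ^ 3 ∣ J}) := by
    rintro ⟨I, J⟩ ⟨hI, hJ⟩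
    exact ⟨(pow_dvd_pow _ (by norm_num)).trans hI, (pow_dvd_pow _ (by norm_num)).trans hJ⟩
  have h := measurableSet_prod_setOf_pow_dvd 3 5 9
  have h' := volume_prod_setOf_pow_dvd 3 5 9
  have h'' := volume_prod_setOf_pow_dvd 3 1 3
  simp only [Nat.cast_ofNat] at h h' h''
  rw [measure_sdiff hsub h.nullMeasurableSet (measure_ne_top _ _), h', h'',
    ← ENNReal.mul_inv (Or.inl (by simp)) (Or.inl (by simp)), ← pow_add,
    ← ENNReal.mul_inv (Or.inl (by simp)) (Or.inl (by simp)), ← pow_add]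

end Volume

section MassU

variable (p : ℕ) [Fact p.Prime]

/-- `|3⁴|_p = 1` for `p ≠ 3` and `|3⁴|_3 = 3⁻⁴`. [folklore] -/
theorem padicNorm_three_pow_four :
    (padicNorm p ((3 : ℚ) ^ 4) : ℝ) = if p = 3 then ((3 : ℝ) ^ 4)⁻¹ else 1 := by
  have hp : p.Prime := Fact.out
  split_ifs with h3
  · subst h3
    rw [IsAbsoluteValue.abv_pow (padicNorm 3), show (3 : ℚ) = ((3 : ℕ) : ℚ) by norm_num,
      padicNorm.padicNorm_p_of_prime]
    push_cast
    rw [inv_pow]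
  · have : padicNorm p ((3 : ℚ) ^ 4) = 1 := by
      rw [show ((3 : ℚ) ^ 4) = ((3 ^ 4 : ℕ) : ℚ) by norm_num, padicNorm.nat_eq_one_iff]
      intro hd
      exact h3 ((Nat.prime_dvd_prime_iff_eq hp Nat.prime_three).mp (hp.dvd_of_dvd_pow hd))
    rw [this]; norm_num

/-- **`M_p(U₁,F) = |3⁴|_p · (1 − p⁻¹⁰)`** for the family of all elliptic curves (the `p`-adic
density of `F_p^{inv} = {(−3A, −27B) : p⁴ ∤ A or p⁶ ∤ B}`; Bhargava–Shankar, eq. (28) and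
Lemma 5.15). [cite: BhargavaShankarAnnals2015, eq. (28) and Lemma 5.15 (arXiv:1006.1002v2 numbering)] -/
theorem localMassU_eq :
    localMassU p = (padicNorm p ((3 : ℚ) ^ 4) : ℝ) * (1 - 1 / (p : ℝ) ^ 10) := by
  have hp : p.Prime := Fact.out
  have hp0 : (p : ℝ) ≠ 0 := by exact_mod_cast hp.ne_zero
  rw [localMassU, invariantPairsAdicClosure_eq, padicNorm_three_pow_four]
  by_cases h3 : p = 3
  · subst h3
    simp only [if_true]
    rw [volume_invariantPairsAdic_three, ENNReal.toReal_sub_of_le ?_ (by simp), ENNReal.toReal_inv,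
      ENNReal.toReal_inv, ENNReal.toReal_pow, ENNReal.toReal_pow]
    · norm_num
    · exact ENNReal.inv_le_inv.mpr (pow_le_pow_right₀ (by norm_num) (by norm_num))
  · rw [if_neg h3, volume_invariantPairsAdic_of_ne_three p h3, ENNReal.toReal_sub_of_le ?_ (by simp),
      ENNReal.toReal_one, ENNReal.toReal_inv, ENNReal.toReal_pow, ENNReal.toReal_natCast]
    · ring
    · exact ENNReal.inv_le_one.mpr (one_le_pow₀ (by exact_mod_cast hp.one_le))

end MassU

section NullSet

variable (p : ℕ) [Fact p.Prime]

/-! ## The discriminant curve `4I³ = J²` is a null set -/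

/-- For fixed `I`, at most two `J ∈ ℤ_p` satisfy `4I³ = J²`. [folklore] -/
theorem finite_setOf_sq_eq (c : ℤ_[p]) : {J : ℤ_[p] | 4 * c ^ 3 - J ^ 2 = 0}.Finite := by
  by_cases h : ∃ J₀ : ℤ_[p], 4 * c ^ 3 - J₀ ^ 2 = 0
  · obtain ⟨J₀, hJ₀⟩ := h
    refine (Set.toFinite ({J₀, -J₀} : Set ℤ_[p])).subset ?_
    intro J hJ
    simp only [mem_setOf_eq] at hJ
    have hsq : J ^ 2 = J₀ ^ 2 := by linear_combination hJ₀ - hJ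
    rcases sq_eq_sq_iff_eq_or_eq_neg.mp hsq with h1 | h1
    · exact Or.inl h1
    · exact Or.inr h1
  · push Not at h
    convert Set.finite_empty
    ext J
    simpa using h J

/-- The discriminant curve `{(I,J) : 4I³ = J²} ⊂ ℤ_p × ℤ_p` is closed, hence measurable. [folklore] -/
theorem measurableSet_discCurve :
    MeasurableSet {IJ : ℤ_[p] × ℤ_[p] | 4 * IJ.1 ^ 3 - IJ.2 ^ 2 = 0} :=
  (isClosed_eq (by fun_prop) continuous_const).measurableSet

/-- **The discriminant curve `4I³ = J²` has measure `0` in `ℤ_p × ℤ_p`** (its `I`-sections have at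
most two points, and points are null); this is "the measure of the set `{(0,J)} ∪ {(I,0)}` …" type
of negligibility used in the proof of Prop. 5.12. [folklore] -/
theorem volume_discCurve : volume {IJ : ℤ_[p] × ℤ_[p] | 4 * IJ.1 ^ 3 - IJ.2 ^ 2 = 0} = 0 := by
  rw [Measure.volume_eq_prod, Measure.prod_apply (measurableSet_discCurve p)]
  have : ∀ I : ℤ_[p], volume (Prod.mk I ⁻¹' {IJ : ℤ_[p] × ℤ_[p] | 4 * IJ.1 ^ 3 - IJ.2 ^ 2 = 0}) = 0 :=
    fun I ↦ (finite_setOf_sq_eq p I).measure_zero _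
  simp_rw [this, lintegral_zero]

end NullSet

section MassV

/-! ## `2`-torsion of `y² = x³ + ax + b` is finite; `E_{I,J}` is elliptic off the discriminant curve -/

/-- Over a field of characteristic `≠ 2`, a Weierstrass curve with `a₁ = a₃ = 0` has finitely many
rational `2`-torsion points: `2P = O` iff `P = O` or `y(P) = 0`, and then `x(P)` is a root of the
`2`-torsion cubic `4x³ + b₂x² + 2b₄x + b₆`. [folklore] -/
theorem finite_torsionBy_two {K : Type*} [Field K] (W : WeierstrassCurve K)
    (h1 : W.a₁ = 0) (h3 : W.a₃ = 0) (h2 : (2 : K) ≠ 0) :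
    ((AddSubgroup.torsionBy W.toAffine.Point 2 : AddSubgroup W.toAffine.Point) :
      Set W.toAffine.Point).Finite := by
  have h4 : (4 : K) ≠ 0 := by
    have : (4 : K) = 2 * 2 := by norm_num
    rw [this]; exact mul_ne_zero h2 h2
  have hq0 : W.twoTorsionPolynomial.toPoly ≠ 0 := Cubic.ne_zero_of_a_ne_zero h4
  -- x-coordinate map
  let f : W.toAffine.Point → Option K := fun P ↦ match P with
    | .zero => none
    | .some x _ _ => some x
  have hroot : ∀ {x y : K} (h : W.toAffine.Nonsingular x y),
      (WeierstrassCurve.Affine.Point.some x y h) ∈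
        (AddSubgroup.torsionBy W.toAffine.Point 2 : AddSubgroup W.toAffine.Point) →
      y = 0 ∧ x ∈ W.twoTorsionPolynomial.roots := by
    intro x y h hP
    have h2P : (2 : ℤ) • WeierstrassCurve.Affine.Point.some x y h = 0 := by
      simpa using hP
    rw [two_zsmul] at h2P
    have hy : y = W.toAffine.negY x y := by
      by_contra hy
      rw [WeierstrassCurve.Affine.Point.add_self_of_Y_ne hy] at h2P
      exact WeierstrassCurve.Affine.Point.some_ne_zero _ h2P
    have hy0 : y = 0 := by
      simp only [WeierstrassCurve.Affine.negY, h1, h3, zero_mul, sub_zero] at hy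
      have : (2 : K) * y = 0 := by linear_combination hy
      rcases mul_eq_zero.mp this with h | h
      · exact absurd h h2
      · exact h
    refine ⟨hy0, ?_⟩
    rw [Cubic.mem_roots_iff hq0]
    have he := h.1
    rw [WeierstrassCurve.Affine.equation_iff, hy0, h1, h3] at he
    simp only [WeierstrassCurve.twoTorsionPolynomial, WeierstrassCurve.b₂, WeierstrassCurve.b₄,
      WeierstrassCurve.b₆, h1, h3]
    linear_combination -4 * he
  -- injectivity of `f` on the `2`-torsion and finiteness of its image
  refine Set.Finite.of_finite_image (f := f) ?_ ?_
  · refine (Set.toFinite (insert none ((fun x : K ↦ (some x : Option K)) ''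
      (W.twoTorsionPolynomial.roots.toFinset : Set K)))).subset ?_
    rintro _ ⟨P, hP, rfl⟩
    rcases P with _ | ⟨x, y, h⟩
    · exact mem_insert _ _
    · exact mem_insert_of_mem _ ⟨x, by simpa using (hroot h hP).2, rfl⟩
  · rintro P hP Q hQ hPQ
    rcases P with _ | ⟨x, y, h⟩ <;> rcases Q with _ | ⟨x', y', h'⟩
    · rfl
    · exact absurd hPQ (by simp [f])
    · exact absurd hPQ (by simp [f])
    · have hx : x = x' := by simpa [f] using hPQ
      have hy : y = y' := by rw [(hroot h hP).1, (hroot h' hQ).1]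
      subst hx hy
      rfl

variable (p : ℕ) [Fact p.Prime]

/-- Off the discriminant curve, `E_{I,J} : y² = x³ − (I/3)x − J/27` is an elliptic curve over `ℚ_p`:
`Δ = 16(4I³ − J²)/27 ≠ 0`. [cite: BhargavaShankarAnnals2015, §5 p. 31 (E_{I,J}; arXiv:1006.1002v2 numbering)] -/
theorem isElliptic_curveOfInvariants {IJ : ℤ_[p] × ℤ_[p]} (h : 4 * IJ.1 ^ 3 - IJ.2 ^ 2 ≠ 0) :
    (curveOfInvariants ℚ_[p] (IJ.1 : ℚ_[p]) (IJ.2 : ℚ_[p])).IsElliptic := by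
  refine ⟨Ne.isUnit ?_⟩
  have hΔ : (curveOfInvariants ℚ_[p] (IJ.1 : ℚ_[p]) (IJ.2 : ℚ_[p])).Δ =
      16 * (4 * (IJ.1 : ℚ_[p]) ^ 3 - (IJ.2 : ℚ_[p]) ^ 2) / 27 := by
    simp only [curveOfInvariants, WeierstrassCurve.Δ, WeierstrassCurve.b₂, WeierstrassCurve.b₄,
      WeierstrassCurve.b₆, WeierstrassCurve.b₈]
    ring
  rw [hΔ]
  have h' : (4 * (IJ.1 : ℚ_[p]) ^ 3 - (IJ.2 : ℚ_[p]) ^ 2) ≠ 0 := by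
    have : ((4 * IJ.1 ^ 3 - IJ.2 ^ 2 : ℤ_[p]) : ℚ_[p]) ≠ 0 := by
      rw [Ne, PadicInt.coe_eq_zero]; exact h
    push_cast at this
    exact this
  exact div_ne_zero (mul_ne_zero (by norm_num) h') (by norm_num)

/-- **Brumer–Kramer evaluates the integrand**: granted Lemma 5.16
(`brumerKramer_card_quotient_two`), off the discriminant curve
`#(E_{I,J}(ℚ_p)/2E_{I,J}(ℚ_p)) / #E_{I,J}(ℚ_p)[2] = 1` for `p ≠ 2` and `= 2` for `p = 2`
(the `2`-torsion being finite and nonempty). [cite: BhargavaShankarAnnals2015, Lemma 5.16 (arXiv:1006.1002v2 numbering)] -/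
theorem localSelmerRatio_eq (hBK : brumerKramer_card_quotient_two) {IJ : ℤ_[p] × ℤ_[p]}
    (h : 4 * IJ.1 ^ 3 - IJ.2 ^ 2 ≠ 0) :
    localSelmerRatio p IJ = if p = 2 then 2 else 1 := by
  haveI := isElliptic_curveOfInvariants p h
  have hcard := hBK p (curveOfInvariants ℚ_[p] (IJ.1 : ℚ_[p]) (IJ.2 : ℚ_[p]))
  have hfin := finite_torsionBy_two (curveOfInvariants ℚ_[p] (IJ.1 : ℚ_[p]) (IJ.2 : ℚ_[p]))
    rfl rfl two_ne_zero
  haveI : Finite (AddSubgroup.torsionBy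
      (curveOfInvariants ℚ_[p] (IJ.1 : ℚ_[p]) (IJ.2 : ℚ_[p])).toAffine.Point 2) := hfin.to_subtype
  have hpos : 0 < Nat.card (AddSubgroup.torsionBy
      (curveOfInvariants ℚ_[p] (IJ.1 : ℚ_[p]) (IJ.2 : ℚ_[p])).toAffine.Point 2) := Nat.card_pos
  have hne : (Nat.card (AddSubgroup.torsionBy
      (curveOfInvariants ℚ_[p] (IJ.1 : ℚ_[p]) (IJ.2 : ℚ_[p])).toAffine.Point 2) : ℝ) ≠ 0 := by
    exact_mod_cast hpos.ne'
  rw [localSelmerRatio, if_pos h, hcard]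
  push_cast
  rw [mul_div_assoc, div_self hne, mul_one]

/-- **`M_p(V,F) = (1 − p⁻²) · c_p · M_p(U₁,F)`**, `c₂ = 2`, `c_p = 1` (`p ≠ 2`), granted Lemma 5.16
(Brumer–Kramer): the integrand equals `c_p` off the null discriminant curve (Bhargava–Shankar,
last display of §5.4). [cite: BhargavaShankarAnnals2015, §5.4 (last display) with Lemma 5.16 (arXiv:1006.1002v2 numbering)] -/
theorem localMassV_eq (hBK : brumerKramer_card_quotient_two) :
    localMassV p = (1 - 1 / (p : ℝ) ^ 2) * (if p = 2 then 2 else 1) * localMassU p := by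
  rw [localMassV, localMassU, mul_assoc]
  congr 1
  have hae : ∀ᵐ IJ ∂(volume.restrict (invariantPairsAdicClosure p)),
      localSelmerRatio p IJ = (if p = 2 then (2 : ℝ) else 1) := by
    refine ae_restrict_of_ae ?_
    have h0 := measure_eq_zero_iff_ae_notMem.mp (volume_discCurve p)
    filter_upwards [h0] with IJ hIJ
    exact localSelmerRatio_eq p hBK hIJ
  rw [integral_congr_ae hae, setIntegral_const, smul_eq_mul, mul_comm]
  rfl

end MassV

end Literature.NumberTheory.EllipticCurves

end
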